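import Summits.HubbardSuperconductivity.HubbardSuperconductivity.Theorems.AnisotropyChordTransferFibre3N1RowObjP
import Summits.HubbardSuperconductivity.HubbardSuperconductivity.Theorems.AnisotropyChordTransferFibre3ClosedExpansions
import Summits.HubbardSuperconductivity.HubbardSuperconductivity.Theorems.AnisotropyChordTransferFibre3OuterMajorants
import Summits.HubbardSuperconductivity.HubbardSuperconductivity.Theorems.AnisotropyChordTransferFibre3Regions

/-!
# Route `AnisotropyChord` / H0 rotor rung, LEVEL 2 row `N₁`: the OBJECT `Â = θ⁴Σ_k F₂(k)² cos kₓ` lies in its `RExpr` bracket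

Second instance of the object layer: for a ground two-magnon profile (`L ≥ 16`, `0 ≤ Δ < 1`) and the true vector
`X = xTrue L Δ λ₂ f a` (`a = Δf(x̂)`),  ★ `aHat_mem`: `(A2lo 2).eval X ≤ θ⁴·Σ_k F₂(k)² cos(2πk₁/L) ≤ (A2hi 2).eval X`.
Same skeleton as `…N1RowObjP.pHat_mem`: region split (`OuterMaj.singleRegionSplit_holds`), block values (`eval_Fh`, `eval_closed`,
and `eval_cosq`: the cosine coordinates `cos(mθ)` of the true vector), closed outer part (`axClosedExpansion_holds`, hatted in
`eval_AclosedFull`), outer tail (`OuterMaj.ax_outer_bound` with `κ̂′ = kap.eval X`, `eval_AtailFull`, `eval_AtailAt`).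
Prover seat `hubbard-h0-rotor-p2` g4; helper for piece A = stmt-HubbardSuperconductivity-23918 of rung 19089
(`--supports`, helper class).  Nothing here proves superconductivity in the Hubbard model; helper lemmas of ONE conditional
reduction (the GM₃ ∀L certificate, Level-2 row `N₁`); the rotor TARGET as originally worded stays FALSE (g15 verdict).
Mathlib + the tree only; no sorry.
-/

set_option linter.dupNamespace false
set_option autoImplicit false

open Literature.Analysis.ValidatedNumerics

namespace Summit.HubbardSuperconductivity.HubbardSuperconductivity.Theorems.AnisotropyChord.Transfer.Fibre3.L2.N1

variable (L : ℕ) [NeZero L] (Δ lam2 : ℝ) (f : Tor L → ℝ)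

/-- the lattice cosine `cos kₓ = cos(2πk₁/L)`. -/
noncomputable def cosx (k : Tor L) : ℝ := Real.cos (2 * Real.pi * k.1.val / L)

/-- the `A` tail majorant per momentum: `2κ′|c|g + κ′²g²`. -/
noncomputable def aMaj (k : Tor L) : ℝ :=
  let κ := kapHat L Δ lam2 f 2 + 2 * aPar L Δ f * cS L Δ lam2 f / (L : ℝ) ^ 2
  2 * κ * (2 * cS L Δ lam2 f * gres L lam2 k + dPar L Δ f) * gres L lam2 k + κ ^ 2 * gres L lam2 k ^ 2

/-! ## The cosine weights on the block -/

/-- block points have `|q₁| ≤ 2`. -/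
theorem natAbs_fst_le_of_gridPts_two : ∀ q ∈ gridPts 2, q.1.natAbs ≤ 2 := by decide

/-- `cosq ↦ cos kₓ` on the block (`k = toTor q`). -/
theorem eval_cosq (a : ℝ) {q : ℤ × ℤ} (hq : q ∈ gridPts 2) :
    (cosq 3 q).eval (xTrue L Δ lam2 f a) = cosx L (B1.toTor L q) := by
  unfold cosx B1.toTor
  dsimp only
  rw [show 2 * Real.pi * (((q.1 : ℤ) : ZMod L).val : ℝ) / L = 2 * Real.pi * (((q.1 : ℤ) : ZMod L).val : ℝ) / L - 0 by ring,
    cos_two_pi_val_intCast_sub L q.1 0, sub_zero]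
  unfold cosq
  by_cases h0 : q.1 = 0
  · rw [if_pos h0]; simp [cst, RExpr.eval, h0]
  · rw [if_neg h0]
    have hle := natAbs_fst_le_of_gridPts_two q hq
    have hpos : 1 ≤ q.1.natAbs := Int.natAbs_pos.2 h0
    simp only [vCos, RExpr.eval, length_gridPts_three]
    rw [show 19 + 2 * 48 + (q.1.natAbs - 1) = 115 + (q.1.natAbs - 1) by omega,
      xTrue_cos L Δ lam2 f a (by omega), show q.1.natAbs - 1 + 1 = q.1.natAbs by omega]
    rw [show 2 * Real.pi * ((q.1 : ℤ) : ℝ) / L = ((q.1 : ℤ) : ℝ) * (2 * Real.pi / L) by ring]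
    rcases Int.natAbs_eq q.1 with h | h
    · rw [h]; simp
    · rw [h]; simp [Real.cos_neg]

/-! ## The pieces of the `Â` bracket at the true vector -/

/-- `AclosedFull ↦ θ⁴Σ_{k≠0} c(k)² cos kₓ` (`AxClosedExpansion`). -/
theorem eval_AclosedFull (hL : 5 ≤ L) (hΔ0 : 0 ≤ Δ) (hΔ1 : Δ < 1) (hf : IsGroundTwoMagnon L Δ lam2 f) (hlam : 0 < lam2)
    (h1 : lam2 < eps1 L) (hu : 0 < cS L Δ lam2 f * Gzero L lam2) :
    AclosedFull.eval (xTrue L Δ lam2 f (Δ * f (K1 L)))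
      = ((2 * Real.pi / L) ^ 2) ^ 2 * ∑ k ∈ (Finset.univ : Finset (Tor L)).erase 0, cK L Δ lam2 f k ^ 2 * cosx L k := by
  set X := xTrue L Δ lam2 f (Δ * f (K1 L)) with hXdef
  obtain ⟨_, dcs, _, ddd, _⟩ := dict_at_xTrue L Δ lam2 f hL hΔ0 hΔ1 hf hlam
  obtain ⟨hX1, hX4, _⟩ : X 1 = Real.pi ^ 2 ∧ X 4 = (2 * Real.pi / L) ^ (2 * 2) * S2n L lam2 ∧
      X 5 = (2 * Real.pi / L) ^ (2 * 3) * S3n L lam2 := xTrue_145 L Δ lam2 f (Δ * f (K1 L))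
  have hX0 : X 0 = (2 * Real.pi / L) ^ 2 := xTrue_zero L Δ lam2 f _
  have hX2 : X 2 = lam2 / (2 * Real.pi / L) ^ 2 := by rw [hXdef, xTrue_lt16 L Δ lam2 f _ (by norm_num)]; rfl
  have hS1 : S1h.eval X = (2 * Real.pi / L) ^ 2 * S1n L lam2 := S1h_eval L Δ lam2 f hL hΔ0 hΔ1 hf hlam hu
  have hLpos : (0 : ℝ) < L := by exact_mod_cast (show 0 < L by omega)
  have hexp := axClosedExpansion_holds L Δ lam2 f hlam h1
  dsimp only at hexp
  unfold cosx
  rw [hexp]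
  have e : AclosedFull.eval X = 4 * cs.eval X ^ 2 * ((1 - X 2 * X 0 * (1 / 4)) * X 4 - X 0 * S1h.eval X * (1 / 4))
      + 4 * cs.eval X * (dd.eval X * X 0) * ((1 - X 2 * X 0 * (1 / 4)) * S1h.eval X - (4 * X 1 - X 0) * (1 / 4))
      - (dd.eval X * X 0) ^ 2 := by
    simp only [AclosedFull, C1h, C2h, Dt, RExpr.eval, cst, vS2, vT, vPi2, vNu]; push_cast; ring
  rw [e, dcs, ddd, hX0, hX1, hX2, hX4, hS1]
  unfold dPar
  have hθ2 : (2 * Real.pi / (L : ℝ)) ^ 2 ≠ 0 := by positivity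
  have hπ2 : Real.pi ^ 2 = (2 * Real.pi / (L : ℝ)) ^ 2 * (L : ℝ) ^ 2 / 4 := by
    field_simp
    ring
  rw [hπ2, pow_mul]
  field_simp

/-- `AtailFull ↦ θ⁴Σ_{k≠0} aMaj(k)`. -/
theorem eval_AtailFull (hL : 12 ≤ L) (hΔ0 : 0 ≤ Δ) (hΔ1 : Δ < 1) (hf : IsGroundTwoMagnon L Δ lam2 f) (hlam : 0 < lam2)
    (h2 : 2 * lam2 < eps1 L) (hu : 0 < cS L Δ lam2 f * Gzero L lam2) :
    AtailFull.eval (xTrue L Δ lam2 f (Δ * f (K1 L)))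
      = ((2 * Real.pi / L) ^ 2) ^ 2 * ∑ k ∈ (Finset.univ : Finset (Tor L)).erase 0, aMaj L Δ lam2 f k := by
  set X := xTrue L Δ lam2 f (Δ * f (K1 L)) with hXdef
  obtain ⟨_, dcs, _, ddd, _⟩ := dict_at_xTrue L Δ lam2 f (by omega) hΔ0 hΔ1 hf hlam
  obtain ⟨_, hX4, _⟩ : X 1 = Real.pi ^ 2 ∧ X 4 = (2 * Real.pi / L) ^ (2 * 2) * S2n L lam2 ∧
      X 5 = (2 * Real.pi / L) ^ (2 * 3) * S3n L lam2 := xTrue_145 L Δ lam2 f (Δ * f (K1 L))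
  have hX0 : X 0 = (2 * Real.pi / L) ^ 2 := xTrue_zero L Δ lam2 f _
  have hS1 : S1h.eval X = (2 * Real.pi / L) ^ 2 * S1n L lam2 := S1h_eval L Δ lam2 f (by omega) hΔ0 hΔ1 hf hlam hu
  have hk : kap.eval X = _ := kap_eval L Δ lam2 f hL hΔ0 hΔ1 hf hlam h2 hu
  have e : AtailFull.eval X = 2 * kap.eval X * (2 * cs.eval X * X 4 + dd.eval X * X 0 * S1h.eval X)
      + kap.eval X ^ 2 * X 4 := by
    simp only [AtailFull, Dt, RExpr.eval, cst, vS2, vT]; push_cast; ring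
  rw [e, hk, dcs, ddd, hX0, hX4, hS1]
  set κ : ℝ := kapHat L Δ lam2 f 2 + 2 * aPar L Δ f * cS L Δ lam2 f / (L : ℝ) ^ 2 with hκ
  set E0 := (Finset.univ : Finset (Tor L)).erase 0 with hE0
  have eg2 : ∑ k ∈ E0, 2 * κ * (2 * cS L Δ lam2 f * gres L lam2 k + dPar L Δ f) * gres L lam2 k
      = 2 * κ * (2 * cS L Δ lam2 f * S2n L lam2 + dPar L Δ f * S1n L lam2) := by
    rw [S2n_eq, S1n_eq, ← sum_erase_zero_gres_pow L lam2 2 (by norm_num), ← sum_erase_zero_gres L lam2, ← hE0,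
      Finset.mul_sum, Finset.mul_sum, ← Finset.sum_add_distrib, Finset.mul_sum]
    refine Finset.sum_congr rfl fun k _ => ?_
    ring
  have eg1 : ∑ k ∈ E0, κ ^ 2 * gres L lam2 k ^ 2 = κ ^ 2 * S2n L lam2 := by
    rw [S2n_eq, ← sum_erase_zero_gres_pow L lam2 2 (by norm_num), ← hE0, Finset.mul_sum]
  have hsum : ∑ k ∈ E0, aMaj L Δ lam2 f k
      = 2 * κ * (2 * cS L Δ lam2 f * S2n L lam2 + dPar L Δ f * S1n L lam2) + κ ^ 2 * S2n L lam2 := by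
    unfold aMaj
    dsimp only
    rw [← hκ, Finset.sum_add_distrib, eg2, eg1]
  rw [hsum]
  unfold dPar
  rw [pow_mul]
  ring

/-- `AtailAt q ↦ θ⁴·aMaj(k)` on the grid. -/
theorem eval_AtailAt (hL : 12 ≤ L) (hΔ0 : 0 ≤ Δ) (hΔ1 : Δ < 1) (hf : IsGroundTwoMagnon L Δ lam2 f) (hlam : 0 < lam2)
    (h2 : 2 * lam2 < eps1 L) (hu : 0 < cS L Δ lam2 f * Gzero L lam2) {q : ℤ × ℤ} (hq : q ∈ gridPts 3) :
    (AtailAt 3 q).eval (xTrue L Δ lam2 f (Δ * f (K1 L))) = ((2 * Real.pi / L) ^ 2) ^ 2 * aMaj L Δ lam2 f (B1.toTor L q) := by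
  set X := xTrue L Δ lam2 f (Δ * f (K1 L)) with hXdef
  have hk : kap.eval X = _ := kap_eval L Δ lam2 f hL hΔ0 hΔ1 hf hlam h2 hu
  obtain ⟨_, hac, _⟩ := eval_closed L Δ lam2 f (by omega) hΔ0 hΔ1 hf hlam hq
  have hG := eval_vG L Δ lam2 f hq (Δ * f (K1 L))
  have e : (AtailAt 3 q).eval X = 2 * kap.eval X * (ach 3 q).eval X * (vG 3 q).eval X
      + kap.eval X ^ 2 * (vG 3 q).eval X ^ 2 := by
    simp only [AtailAt, RExpr.eval, cst]; push_cast; ring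
  rw [e, hk, hac, hG]
  unfold aMaj
  ring

/-! ## ★ The object `Â` is in its bracket -/

/-- ★★ **`Â = θ⁴Σ_k F₂(k)² cos kₓ ∈ [A2lo, A2hi]` at the true vector** (ground profile, `L ≥ 16`, `0 ≤ Δ < 1`, `c_sG̃(0) > 0`). -/
theorem aHat_mem (hL : 16 ≤ L) (hΔ0 : 0 ≤ Δ) (hΔ1 : Δ < 1) (hf : IsGroundTwoMagnon L Δ lam2 f) (hlam : 0 < lam2)
    (h2 : 2 * lam2 < eps1 L) (hu : 0 < cS L Δ lam2 f * Gzero L lam2) :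
    (A2lo 2).eval (xTrue L Δ lam2 f (Δ * f (K1 L))) ≤ ((2 * Real.pi / L) ^ 2) ^ 2 * ∑ k : Tor L, F2 L f k ^ 2 * cosx L k ∧
    ((2 * Real.pi / L) ^ 2) ^ 2 * ∑ k : Tor L, F2 L f k ^ 2 * cosx L k ≤ (A2hi 2).eval (xTrue L Δ lam2 f (Δ * f (K1 L))) := by
  classical
  set X := xTrue L Δ lam2 f (Δ * f (K1 L)) with hXdef
  set t : ℝ := (2 * Real.pi / L) ^ 2 with htdef
  have hLpos : (0 : ℝ) < L := by exact_mod_cast (show 0 < L by omega)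
  have ht2 : 0 ≤ t ^ 2 := by positivity
  -- the pieces
  have hF0 : F0h.eval X = t * F2 L f 0 := eval_F0h L Δ lam2 f (by omega) hΔ0 hΔ1 hf hlam
  have hFh : ∀ q ∈ gridPts 2, (Fh 3 q).eval X = t * F2 L f (B1.toTor L q) :=
    fun q hq => eval_Fh L Δ lam2 f (by omega) hΔ0 hΔ1 hf hlam (gridPts_two_sub q hq)
  have hch : ∀ q ∈ gridPts 2, (ch 3 q).eval X = t * cK L Δ lam2 f (B1.toTor L q) :=
    fun q hq => (eval_closed L Δ lam2 f (by omega) hΔ0 hΔ1 hf hlam (gridPts_two_sub q hq)).1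
  have hcq : ∀ q ∈ gridPts 2, (cosq 3 q).eval X = cosx L (B1.toTor L q) :=
    fun q hq => eval_cosq L Δ lam2 f (Δ * f (K1 L)) hq
  have htl : ∀ q ∈ gridPts 2, (AtailAt 3 q).eval X = t ^ 2 * aMaj L Δ lam2 f (B1.toTor L q) :=
    fun q hq => eval_AtailAt L Δ lam2 f (by omega) hΔ0 hΔ1 hf hlam h2 hu (gridPts_two_sub q hq)
  have hcl : AclosedFull.eval X = t ^ 2 * ∑ k ∈ (Finset.univ : Finset (Tor L)).erase 0, cK L Δ lam2 f k ^ 2 * cosx L k :=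
    eval_AclosedFull L Δ lam2 f (by omega) hΔ0 hΔ1 hf hlam (by linarith) hu
  have htf : AtailFull.eval X = t ^ 2 * ∑ k ∈ (Finset.univ : Finset (Tor L)).erase 0, aMaj L Δ lam2 f k :=
    eval_AtailFull L Δ lam2 f (by omega) hΔ0 hΔ1 hf hlam h2 hu
  -- block list sums ↦ Finset sums
  have bF : ((block1 2).map fun q => (RExpr.mul (.sq (Fh 3 q)) (cosq 3 q)).eval X).sum
      = t ^ 2 * ∑ k ∈ Fibre3.block1 L 2, F2 L f k ^ 2 * cosx L k := by
    rw [block1_sum_eq L (by omega), ← List.sum_map_mul_left]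
    refine congrArg List.sum (List.map_congr_left fun q hq => ?_)
    simp only [RExpr.eval]; rw [hFh q hq, hcq q hq]; ring
  have bC : ((block1 2).map fun q => (RExpr.mul (.sq (ch 3 q)) (cosq 3 q)).eval X).sum
      = t ^ 2 * ∑ k ∈ Fibre3.block1 L 2, cK L Δ lam2 f k ^ 2 * cosx L k := by
    rw [block1_sum_eq L (by omega), ← List.sum_map_mul_left]
    refine congrArg List.sum (List.map_congr_left fun q hq => ?_)
    simp only [RExpr.eval]; rw [hch q hq, hcq q hq]; ring
  have bT : ((block1 2).map fun q => (AtailAt 3 q).eval X).sum = t ^ 2 * ∑ k ∈ Fibre3.block1 L 2, aMaj L Δ lam2 f k := by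
    rw [block1_sum_eq L (by omega), ← List.sum_map_mul_left]
    exact congrArg List.sum (List.map_congr_left fun q hq => htl q hq)
  -- the brackets evaluated
  have ecore : (A2core 2).eval X = t ^ 2 * (F2 L f 0 ^ 2 + ∑ k ∈ Fibre3.block1 L 2, F2 L f k ^ 2 * cosx L k
      + (∑ k ∈ (Finset.univ : Finset (Tor L)).erase 0, cK L Δ lam2 f k ^ 2 * cosx L k
        - ∑ k ∈ Fibre3.block1 L 2, cK L Δ lam2 f k ^ 2 * cosx L k)) := by
    simp only [A2core, rsum, RExpr.eval, eval_rsum, List.map_map, Nat.reduceAdd]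
    rw [hF0, hcl]
    have h1 : (List.map ((fun e => e.eval X) ∘ fun q => RExpr.mul (.sq (Fh 3 q)) (cosq 3 q)) (block1 2)).sum
        = t ^ 2 * ∑ k ∈ Fibre3.block1 L 2, F2 L f k ^ 2 * cosx L k := by rw [← bF]; rfl
    have h2' : (List.map ((fun e => e.eval X) ∘ fun q => RExpr.mul (.sq (ch 3 q)) (cosq 3 q)) (block1 2)).sum
        = t ^ 2 * ∑ k ∈ Fibre3.block1 L 2, cK L Δ lam2 f k ^ 2 * cosx L k := by rw [← bC]; rfl
    rw [h1, h2']; ring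
  have etail : (A2tail 2).eval X = max (t ^ 2 * (∑ k ∈ (Finset.univ : Finset (Tor L)).erase 0, aMaj L Δ lam2 f k
      - ∑ k ∈ Fibre3.block1 L 2, aMaj L Δ lam2 f k)) 0 := by
    simp only [A2tail, RExpr.eval, eval_rsum, List.map_map, cst, Nat.reduceAdd]
    have h3 : (List.map ((fun e => e.eval X) ∘ fun q => AtailAt 3 q) (block1 2)).sum
        = t ^ 2 * ∑ k ∈ Fibre3.block1 L 2, aMaj L Δ lam2 f k := by rw [← bT]; rfl
    rw [htf, h3]; push_cast; congr 1; ring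
  have ehi : (A2hi 2).eval X = (A2core 2).eval X + (A2tail 2).eval X := by simp only [A2hi, RExpr.eval]
  have elo : (A2lo 2).eval X = (A2core 2).eval X - (A2tail 2).eval X := by simp only [A2lo, RExpr.eval]
  -- the true sum decomposed
  have split := OuterMaj.singleRegionSplit_holds L 2 (by omega) (fun k => F2 L f k ^ 2 * cosx L k)
  have hcos0 : cosx L (0 : Tor L) = 1 := by unfold cosx; simp
  have hout : ∑ k ∈ Fibre3.outer1 L 2, F2 L f k ^ 2 * cosx L k
      = (∑ k ∈ (Finset.univ : Finset (Tor L)).erase 0, cK L Δ lam2 f k ^ 2 * cosx L k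
          - ∑ k ∈ Fibre3.block1 L 2, cK L Δ lam2 f k ^ 2 * cosx L k)
        + ∑ k ∈ Fibre3.outer1 L 2, (F2 L f k ^ 2 - cK L Δ lam2 f k ^ 2) * cosx L k := by
    rw [← outer1_sum_eq L (by omega), ← Finset.sum_add_distrib]
    refine Finset.sum_congr rfl fun k _ => ?_; ring
  have hbd := OuterMaj.ax_outer_bound L (by omega) hΔ0 hΔ1 hf 2 (by omega)
    (OuterMaj.f2ClosedPlusTail_holds L (by omega) hΔ0) (OuterMaj.outerEnergyFloor_holds L 2)
  have hmaj : ∑ k ∈ Fibre3.outer1 L 2, aMaj L Δ lam2 f k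
      = ∑ k ∈ (Finset.univ : Finset (Tor L)).erase 0, aMaj L Δ lam2 f k - ∑ k ∈ Fibre3.block1 L 2, aMaj L Δ lam2 f k :=
    outer1_sum_eq L (by omega) _
  have habs : |∑ k ∈ Fibre3.outer1 L 2, (F2 L f k ^ 2 - cK L Δ lam2 f k ^ 2) * cosx L k|
      ≤ ∑ k ∈ Fibre3.outer1 L 2, aMaj L Δ lam2 f k := by
    unfold cosx
    refine hbd.trans (le_of_eq ?_)
    refine Finset.sum_congr rfl fun k _ => ?_
    unfold aMaj; ring
  rw [hmaj] at habs
  obtain ⟨hlow, hupp⟩ := abs_le.1 habs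
  have key : t ^ 2 * ∑ k : Tor L, F2 L f k ^ 2 * cosx L k
      = t ^ 2 * (F2 L f 0 ^ 2 + ∑ k ∈ Fibre3.block1 L 2, F2 L f k ^ 2 * cosx L k
        + (∑ k ∈ (Finset.univ : Finset (Tor L)).erase 0, cK L Δ lam2 f k ^ 2 * cosx L k
          - ∑ k ∈ Fibre3.block1 L 2, cK L Δ lam2 f k ^ 2 * cosx L k))
        + t ^ 2 * ∑ k ∈ Fibre3.outer1 L 2, (F2 L f k ^ 2 - cK L Δ lam2 f k ^ 2) * cosx L k := by
    rw [split, hout, hcos0]; ring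
  rw [ehi, elo, ecore, etail, key]
  have hm1 := le_max_left (t ^ 2 * (∑ k ∈ (Finset.univ : Finset (Tor L)).erase 0, aMaj L Δ lam2 f k
          - ∑ k ∈ Fibre3.block1 L 2, aMaj L Δ lam2 f k)) 0
  have hA := mul_le_mul_of_nonneg_left hupp ht2
  have hB := mul_le_mul_of_nonneg_left hlow ht2
  constructor
  · nlinarith
  · nlinarith

end Summit.HubbardSuperconductivity.HubbardSuperconductivity.Theorems.AnisotropyChord.Transfer.Fibre3.L2.N1
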